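import Summits.BirchSwinnertonDyer.BirchSwinnertonDyer.Theorems.ResidualThetaTransportAtTwoRlfTwistedCasselsOfEventualLevel
import Summits.BirchSwinnertonDyer.BirchSwinnertonDyer.Theorems.ResidualThetaTransportAtTwoRlfTwistedLocalDescentAwayP
import Summits.BirchSwinnertonDyer.BirchSwinnertonDyer.Theorems.ResidualThetaTransportAtTwoRlfOfTwistedDescent
import HarnessLib

/-!
# Road T for item 23110, (R6)-glue (B) at `ℚ`/`2`: (TCAS♯) — the `htwCas` hypothesis of `SignedEC.TwistedSurj.rlf2_of_twistedDescent`
# VERBATIM — from the EVENTUAL-level twisted Cassels statement (TCAS-K)_ev ALONE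

Route `ResidualThetaTransportAtTwo` (RTT, crux r201 `ResidualLambdaFormulaNegDiscAtTwo`, stmt-BirchSwinnertonDyer-23110) /
`ThetaPartnerAtTwo` (TP2). Seat `prover-bsd-wall-tp2-p2x-w3` g12 (the lead tp2-p2x g12's (R6) ask of 18:26/18:32/18:38Z); `--supports
stmt-BirchSwinnertonDyer-23110`. THEOREMS ONLY (no definition, no named fact, no `sorry`); route-independent; closes nothing.

The lead's `SignedEC.TwistedSurj.twistedCassels_sharp_of_eventualLevel` (p657379) reduces (TCAS♯) to the eventual-level twisted Cassels
statement `hlev` (Greenberg's Prop. 4.13 + Remark for the DIVISIBLE `A_s`, read at finite levels «eventually in `J`»; research input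
(R5')) and the twisted local `Γ`-descent `hloc` at `S₀`. At `K = ℚ`, `p = 2`, for the door's ARBITRARY ADMISSIBLE local data
`g` (`γ^{N_v} ∈ ker κ · g_v|_{ℚ̄}`, `N_v = 2^{v₂((ℓ_v²−1)/8)}`), `hloc` is a THEOREM: `κ(g_v|) = N_v` (`apply_eq_ofAdd_of_pow_eq_mul`),
`N_v = 2^{s_v}` is the EXACT local index (`SignedEC.exists_localGenerator_two` + `SignedEC.localGenerator_exponent_eq`: the image of
`Γ_{ℚ_ℓ}` in `Gal(ℚ_∞/ℚ) ≅ ℤ₂` is `2^{s_v} ℤ₂`), so `g_v` has maximal norm and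
`SignedEC.TwistedLocalDescent.exists_twistedTorsionToLocalH1_eq_of_zsmul_conjH1_eq` (p657270; the lead's Literature twin
`WeierstrassCurve.exists_twistedTorsionToLocalH1_eq_of_zsmul_conjH1_eq`, p656986) applies.

* `twistedCassels_sharp_two_of_eventualLevel` — `κ` cyclotomic with topological generator `γ`, `S₀ ∌ 2` finite, `E/ℚ` elliptic, `u` odd:
  (TCAS-K)_ev(u) ⟹ (TCAS♯)(u) in the exact shape of the `htwCas` binder of `rlf2_of_twistedDescent`.

HONEST FRAMING: (TCAS-K)_ev is displayed (research input (R5')); closes nothing; 23110 is NOT proved; BSD is not proved by any of this.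
References: [GreenbergLNM1716] §4 Prop. 4.13 and Remark (pp. 122–124), proof of Lemma 4.7 (p. 108); [Washington1997] §13.1.
-/

set_option autoImplicit false
set_option linter.dupNamespace false

noncomputable section

open scoped Classical NumberField

open NumberField IsDedekindDomain

namespace Summit.BirchSwinnertonDyer.BirchSwinnertonDyer.Theorems.SignedEC.TwistedLocalDescent

open Literature.NumberTheory.EllipticCurves Literature.NumberTheory.GaloisRepresentations
  WeierstrassCurve ZpExtension Literature.NumberTheory.EllipticCurves.Kobayashi2003
  Literature.NumberTheory.EllipticCurves.GreenbergVatsal2000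

/-- **(TCAS♯) at `ℚ`/`2` from (TCAS-K)_ev alone** — the `htwCas` hypothesis of `SignedEC.TwistedSurj.rlf2_of_twistedDescent` verbatim,
for every admissible local datum `g`: `twistedCassels_sharp_of_eventualLevel` with `hloc` discharged by the twisted local `Γ`-descent
at `v ∤ 2` (`exists_twistedTorsionToLocalH1_eq_of_zsmul_conjH1_eq`), the generating clause coming from the exact local index
`N_v = 2^{s_v}` (`SignedEC.exists_localGenerator_two`, `SignedEC.localGenerator_exponent_eq`).
[cite: GreenbergLNM1716, §4 Prop. 4.13 Remark (p. 123), proof of Lemma 4.7 (p. 108), p. 124] [cite: Washington1997, §13.1] -/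
theorem twistedCassels_sharp_two_of_eventualLevel (κ : ZpExtension ℚ 2) (γ : Field.absoluteGaloisGroup ℚ) (hκ : κ.IsCyclotomic)
    (hγ : κ.IsTopGenerator γ) (S₀ : Finset (HeightOneSpectrum (𝓞 ℚ))) (hS2 : ∀ v ∈ S₀, ((2 : ℕ) : 𝓞 ℚ) ∉ v.asIdeal)
    (E : WeierstrassCurve ℚ) [E.IsElliptic] {u : ℤ} (hu : ((2 : ℕ) : ℤ) ∣ u - 1)
    (hlev : ∀ (J : ℕ) (t : ∀ v : HeightOneSpectrum (𝓞 ℚ),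
        galoisCohomology ((E.twistedTorsionGaloisModule 2 κ J u hu).restrictField (v.adicCompletion ℚ)) 1),
      ∃ (J' : ℕ) (hJ : J ≤ J') (x : galoisCohomology (E.twistedTorsionGaloisModule 2 κ J' u hu) 1),
        E.twistedTorsionToH1 2 κ J' u hu x ∈
            unramifiedOutside κ.kerSubgroup ↥(E.geomPrimaryTorsion 2) 2 (↑S₀ : Set (HeightOneSpectrum (𝓞 ℚ))) ⊓
              ⨅ (v : HeightOneSpectrum (𝓞 ℚ)) (_ : ((2 : ℕ) : 𝓞 ℚ) ∈ v.asIdeal) (σ : Field.absoluteGaloisGroup ℚ),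
                (localKummerOverOfEmb E 2 κ.kerSubgroup (closureEmb (K := ℚ) (v.adicCompletion ℚ))
                  (⨆ n : ℕ, signedLocalPoints κ (v.adicCompletion ℚ) E 1 n)).comap (E.conjH1 2 κ.kerSubgroup σ) ∧
          ∀ v ∈ S₀, galoisCohomology.res (E.twistedTorsionGaloisModule 2 κ J' u hu) (v.adicCompletion ℚ) 1 x =
            galoisCohomology.map ((E.twistedTorsionIncl 2 κ hJ u hu).restrictField (v.adicCompletion ℚ)) 1 (t v)) :
    ∀ g : (∀ v : HeightOneSpectrum (𝓞 ℚ), Field.absoluteGaloisGroup (v.adicCompletion ℚ)),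
      (∀ v ∈ S₀, ∃ h ∈ κ.kerSubgroup, γ ^ 2 ^ padicValNat 2 ((Rat.HeightOneSpectrum.natGenerator v ^ 2 - 1) / 8) =
        h * resGal (K := ℚ) (v.adicCompletion ℚ) (g v)) →
      ∀ z : (∀ v : HeightOneSpectrum (𝓞 ℚ),
          discreteH1 (localSubgroup κ.kerSubgroup (v.adicCompletion ℚ)) (localPoints E (v.adicCompletion ℚ))),
        (∀ v ∈ S₀, ∃ k : ℕ, 2 ^ k • z v = 0) →
        (∀ v ∈ S₀, u ^ 2 ^ padicValNat 2 ((Rat.HeightOneSpectrum.natGenerator v ^ 2 - 1) / 8) •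
            Literature.NumberTheory.EllipticCurves.conjH1 (localSubgroup κ.kerSubgroup (v.adicCompletion ℚ))
              (localPoints E (v.adicCompletion ℚ)) (g v) (z v) = z v) →
        ∃ c ∈ unramifiedOutside κ.kerSubgroup ↥(E.geomPrimaryTorsion 2) 2 (↑S₀ : Set (HeightOneSpectrum (𝓞 ℚ))) ⊓
            ⨅ (v : HeightOneSpectrum (𝓞 ℚ)) (_ : ((2 : ℕ) : 𝓞 ℚ) ∈ v.asIdeal) (σ : Field.absoluteGaloisGroup ℚ),
              (localKummerOverOfEmb E 2 κ.kerSubgroup (closureEmb (K := ℚ) (v.adicCompletion ℚ))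
                (⨆ n : ℕ, signedLocalPoints κ (v.adicCompletion ℚ) E 1 n)).comap (E.conjH1 2 κ.kerSubgroup σ),
          u • E.conjH1 2 κ.kerSubgroup γ c = c ∧
            ∀ v ∈ S₀, E.localResOver 2 κ.kerSubgroup (v.adicCompletion ℚ) c = z v := by
  intro g hgadm z hztor hzeig
  -- the door's local index `N_v = 2^{v₂((ℓ_v²−1)/8)}`
  let N : HeightOneSpectrum (𝓞 ℚ) → ℕ := fun v ↦ 2 ^ padicValNat 2 ((Rat.HeightOneSpectrum.natGenerator v ^ 2 - 1) / 8)
  -- at each `v ∈ S₀`: `κ(g_v|) = N_v`, `g_v| ∉ ker κ`, and `g_v` has maximal norm (`N_v = 2^{s_v}` is the exact local index)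
  have hgN : ∀ v ∈ S₀, κ (resGal (K := ℚ) (v.adicCompletion ℚ) (g v)) = Multiplicative.ofAdd ((N v : ℕ) : ℤ_[2]) := by
    intro v hv
    obtain ⟨h, hh, hN⟩ := hgadm v hv
    exact apply_eq_ofAdd_of_pow_eq_mul κ hγ hh hN
  have hNne : ∀ v, ((N v : ℕ) : ℤ_[2]) ≠ 0 := fun v ↦ by
    simp only [N, Nat.cast_pow, Nat.cast_ofNat]
    exact pow_ne_zero _ (by exact_mod_cast (Fact.out : (2 : ℕ).Prime).ne_zero)
  have hg0 : ∀ v ∈ S₀, resGal (K := ℚ) (v.adicCompletion ℚ) (g v) ∉ κ.kerSubgroup := by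
    intro v hv hmem
    rw [ZpExtension.mem_kerSubgroup, hgN v hv] at hmem
    exact hNne v (by rw [← toAdd_ofAdd ((N v : ℕ) : ℤ_[2]), hmem, toAdd_one])
  have hmax : ∀ v ∈ S₀, ∀ σ : Field.absoluteGaloisGroup (v.adicCompletion ℚ),
      ‖(κ (resGal (K := ℚ) (v.adicCompletion ℚ) σ)).toAdd‖ ≤ ‖(κ (resGal (K := ℚ) (v.adicCompletion ℚ) (g v))).toAdd‖ := by
    intro v hv σ
    have hpv := hS2 v hv
    obtain ⟨s, g₀, -, h2, h3, -, -⟩ := SignedEC.exists_localGenerator_two E κ hκ hγ v hpv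
    have hs : s = padicValNat 2 (Rat.HeightOneSpectrum.natGenerator v ^ 2 - 1) - 3 :=
      SignedEC.localGenerator_exponent_eq κ hκ v hpv h3 h2
    have hℓprime : (Rat.HeightOneSpectrum.natGenerator v).Prime := Rat.HeightOneSpectrum.prime_natGenerator v
    have hℓp : Rat.HeightOneSpectrum.natGenerator v ≠ 2 :=
      Summit.BirchSwinnertonDyer.Rank1Residual.X2.EulerFactorInvariants.natGenerator_ne_of_natCast_not_mem v hpv
    have hodd : Odd (Rat.HeightOneSpectrum.natGenerator v) := hℓprime.odd_of_ne_two hℓp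
    have h8 : padicValNat 2 ((Rat.HeightOneSpectrum.natGenerator v ^ 2 - 1) / 8) =
        padicValNat 2 (Rat.HeightOneSpectrum.natGenerator v ^ 2 - 1) - 3 := by
      rw [show (8 : ℕ) = 2 ^ 3 by norm_num,
        padicValNat.div_pow ((SignedTransportAtTwo.eight_dvd_sq_sub_one hodd).trans (by norm_num))]
    have hNs : N v = 2 ^ s := by simp only [N, h8, hs]
    -- `κ(g_v|).toAdd = N_v = 2^s = κ(g₀|).toAdd`
    have hgv : (κ (resGal (K := ℚ) (v.adicCompletion ℚ) (g v))).toAdd =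
        (κ (resGal (K := ℚ) (v.adicCompletion ℚ) g₀)).toAdd := by
      rw [hgN v hv, toAdd_ofAdd, h3, hNs, Nat.cast_pow, Nat.cast_ofNat]
    obtain ⟨zσ, hzσ⟩ := h2 σ
    rw [hgv, hzσ, norm_mul]
    exact mul_le_of_le_one_left (norm_nonneg _) (PadicInt.norm_le_one zσ)
  exact TwistedSurj.twistedCassels_sharp_of_eventualLevel E 2 κ 1 hγ S₀ hu N g hlev
    (fun v hv z' hz' heig' ↦ exists_twistedTorsionToLocalH1_eq_of_zsmul_conjH1_eq E κ hu v (hS2 v hv) (hgN v hv) (hg0 v hv)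
      (hmax v hv) z' hz' heig')
    z hztor hzeig

end Summit.BirchSwinnertonDyer.BirchSwinnertonDyer.Theorems.SignedEC.TwistedLocalDescent

end
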